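import Literature.Probability.Percolation.QuadLowestCrossingProofs
import HarnessLib

/-!
# Self-duality of joint sequential limits, part B: the dual chain ("at least one")
# (crux `SubseqCardy`, stmt-CriticalPhenomena-5768, line `registered`, lead c4, W3)

Route `CardyAnchoredRigidity` (decl shared with `CardyLocalRigidity`), sub-problem `CardyFormulaZ2`.
W3 is the GENERAL SELF-DUALITY `g R + g R⁺ = 1` of every joint sequential limit `g` of the
bond-`ℤ²` crossing probabilities on every conformal rectangle `R` (`R⁺` = the same carrier with the
other pair of opposite arcs).  This file is the mesh-level "at least one of the two crossings
occurs":

* `selfDual_chart_atLeastOne` (registered sub-goal) — if, at mesh `δ`, the model square charted by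
  `Φ` has NO open crossing between `Φ(bottom)` and `Φ(top)`
  (`¬ ChartCrossed (swapC.trans Φ) (-1) 1 (-1) 1 δ ω`), then the dual configuration `dualConfig ω`,
  drawn on the dual lattice `δℤ² + δ(½,½)` (chart `Φ - dualShift δ`), has a left-to-right
  crossing of the `ν`-NARROWER and `ν`-TALLER rectangle `[-1+ν, 1-ν] × [-1-ν, 1+ν]`, where
  `ν ≤ 1` bounds the chart displacement `dist (Φ⁻¹ p) (Φ⁻¹ q)` of plane displacements
  `dist p q ≤ 4δ` at points `q ∈ Φ(B̄(0,5))` (hypothesis; a modulus of continuity of `Φ⁻¹`).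

Proof (`SelfDualDualChain.chartCrossed_dualConfig_of_not_chartCrossed`) = Part 1 of
`SSContinuity.chartCrossed_dualConfig_of_topMove` for this rectangle: the dual path `β` of the
uncrossed square (`exists_dualPath_of_not_chartCrossed`, top-to-bottom in the swapped chart), the
dual-open chain of faces along the planar path `Φ ∘ swap ∘ β` (`exists_dualChain`; its degenerate
alternative "endpoints within `4δ`" would put the two horizontal sides within chart distance
`ν ≤ 1 < 2`), pulled back by `Φ⁻¹` (a continuum within chart distance `ν` of
`swap ∘ β ⊆ [-1,1]²`, reaching `re ≤ -1+ν` and `re ≥ 1-ν`) and trimmed to the levels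
`re = -1+ν`, `re = 1-ν` (`exists_subcontinuum_between_levels`).

References: O. Schramm, S. Smirnov, Ann. Probab. 39 (2011) 1768–1814, arXiv:1101.5820, proof of
Lemma 6.1 ("hence there is a dual closed crossing") [SchrammSmirnov2011]; B. Bollobás, O. Riordan,
*Percolation* (2006), Ch. 1 p. 15 (the dual lattice `ℤ² + (½,½)`) [BollobasRiordan2006].
-/

namespace Summit.CriticalPhenomena.CardyFormulaZ2.Cruxes.SubseqCardy.Birth

open Set Metric Complex
open Literature.Probability.LatticeModels
open Literature.Probability.Percolation
open Literature.Probability.Percolation.SSContinuity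

namespace SelfDualDualChain

/-- A point of the square `[-1,1]²`, swapped, has norm `≤ 5` (indeed `≤ 2`:
`‖u‖ ≤ |re u| + |im u|`). [folklore] -/
theorem norm_swapC_le {u : ℂ} (hu : u ∈ Icc (-1 : ℝ) 1 ×ℂ Icc (-1 : ℝ) 1) : ‖swapC u‖ ≤ 5 := by
  obtain ⟨hre, him⟩ := hu
  have h1 : |(swapC u).re| ≤ 1 := by rw [swapC_re]; exact abs_le.2 ⟨him.1, him.2⟩
  have h2 : |(swapC u).im| ≤ 1 := by rw [swapC_im]; exact abs_le.2 ⟨hre.1, hre.2⟩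
  linarith [Complex.norm_le_abs_re_add_abs_im (swapC u)]

/-- **The dual chain of an uncrossed charted square, pulled back and trimmed.**  If the square
`[-1,1]²` charted by `Φ ∘ swap` is not crossed at mesh `δ` (no open crossing of `Φ([-1,1]²)`
between the images of the horizontal sides), and `Φ⁻¹` moves by at most `ν ≤ 1` under plane
displacements `≤ 4δ` from points of `Φ(B̄(0,5))`, then for the dual configuration and the chart
`z ↦ Φ z - δ(½,½)` the rectangle `[-1+ν, 1-ν] × [-1-ν, 1+ν]` is crossed: the dual chain
(`exists_dualChain`) along the dual path of the uncrossed square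
(`exists_dualPath_of_not_chartCrossed`), pulled back by `Φ⁻¹` and trimmed to the levels
`re = -1+ν`, `re = 1-ν` (`exists_subcontinuum_between_levels`).
[cite: SchrammSmirnov2011, proof of Lemma 6.1] -/
theorem chartCrossed_dualConfig_of_not_chartCrossed (Φ : ℂ ≃ₜ ℂ) {δ ν : ℝ} (hδ : 0 < δ)
    (hν1 : ν ≤ 1)
    (hmod : ∀ p q : ℂ, q ∈ Φ '' closedBall (0 : ℂ) 5 → dist p q ≤ 4 * δ →
      dist (Φ.symm p) (Φ.symm q) ≤ ν)
    {ω : BondConfig (Site 2)} (hncr : ¬ ChartCrossed (swapC.trans Φ) (-1) 1 (-1) 1 δ ω) :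
    ChartCrossed (Φ.trans (Homeomorph.addRight (-dualShift δ))) (-1 + ν) (1 - ν) (-1 - ν) (1 + ν)
      δ (dualConfig ω) := by
  have hG : ∀ w, (Φ.trans (Homeomorph.addRight (-dualShift δ))) w = Φ w - dualShift δ := fun w => by
    simp [sub_eq_add_neg]
  -- the dual path of the uncrossed square (top-to-bottom in the swapped chart)
  obtain ⟨β, hβc, hβR, hβ0, hβ1, hβO⟩ :=
    exists_dualPath_of_not_chartCrossed (swapC.trans Φ) (by norm_num : (-1 : ℝ) < 1)
      (by norm_num : (-1 : ℝ) < 1) hδ hncr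
  have hβB : ∀ t ∈ Icc (0 : ℝ) 1, Φ (swapC (β t)) ∈ Φ '' closedBall (0 : ℂ) 5 := fun t ht =>
    ⟨swapC (β t), by simpa using norm_swapC_le (hβR ht), rfl⟩
  -- the dual chain along the planar path `Φ ∘ swap ∘ β`, which misses the open edges
  rcases exists_dualChain hδ (γ := fun t => Φ (swapC (β t)))
      (Φ.continuous.comp_continuousOn (swapC.continuous.comp_continuousOn hβc))
      (fun t ht h => hβO t ht (Or.inl h)) with hclose | ⟨C, hCc, hCconn, -, hCO, hCnear, hC0, hC1⟩
  · -- endpoints in a common face: impossible, the horizontal sides are `2 > ν` apart in the chart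
    exfalso
    have h := hmod (Φ (swapC (β 0))) (Φ (swapC (β 1))) (hβB 1 ⟨zero_le_one, le_rfl⟩) hclose
    simp only [Homeomorph.symm_apply_apply] at h
    have := (abs_re_im_le_dist (swapC (β 0)) (swapC (β 1))).1
    rw [swapC_re, swapC_re, hβ0, hβ1, abs_le] at this
    linarith [this.2, h]
  · -- the chain pulled back to the chart
    set K₀ : Set ℂ := Φ.symm '' C with hK₀
    have hK₀c : IsCompact K₀ := hCc.image Φ.symm.continuous
    have hK₀conn : IsPreconnected K₀ := hCconn.image _ Φ.symm.continuous.continuousOn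
    -- chart positions of the chain: within `ν` of `swap ∘ β ⊆ [-1,1]²`
    have hpos : ∀ z ∈ C, ∃ t ∈ Icc (0 : ℝ) 1, dist (Φ.symm z) (swapC (β t)) ≤ ν := fun z hz => by
      obtain ⟨t, ht, hd⟩ := hCnear z hz
      refine ⟨t, ht, ?_⟩
      have := hmod z _ (hβB t ht) hd
      simpa using this
    have him : ∀ z ∈ C, -1 - ν ≤ (Φ.symm z).im ∧ (Φ.symm z).im ≤ 1 + ν := fun z hz => by
      obtain ⟨t, ht, hd⟩ := hpos z hz
      have h1 := (abs_re_im_le_dist (Φ.symm z) (swapC (β t))).2.trans hd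
      rw [swapC_im, abs_le] at h1
      have hβt := (hβR ht).1
      exact ⟨by linarith [h1.1, hβt.1], by linarith [h1.2, hβt.2]⟩
    obtain ⟨z0, hz0, hz0d⟩ := hC0
    obtain ⟨z1, hz1, hz1d⟩ := hC1
    have hre0 : 1 - ν ≤ (Φ.symm z0).re := by
      have := hmod z0 _ (hβB 0 ⟨le_rfl, zero_le_one⟩) hz0d
      simp only [Homeomorph.symm_apply_apply] at this
      have h1 := (abs_re_im_le_dist (Φ.symm z0) (swapC (β 0))).1.trans this
      rw [swapC_re, hβ0, abs_le] at h1
      linarith [h1.1]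
    have hre1 : (Φ.symm z1).re ≤ -1 + ν := by
      have := hmod z1 _ (hβB 1 ⟨zero_le_one, le_rfl⟩) hz1d
      simp only [Homeomorph.symm_apply_apply] at this
      have h1 := (abs_re_im_le_dist (Φ.symm z1) (swapC (β 1))).1.trans this
      rw [swapC_re, hβ1, abs_le] at h1
      linarith [h1.2]
    -- trimmed to the levels `re = -1 + ν` and `re = 1 - ν`
    obtain ⟨K₁, hK₁K, hK₁c, hK₁conn, hK₁bd, ⟨pa, hpa, hpar⟩, ⟨pb, hpb, hpbr⟩⟩ :=
      exists_subcontinuum_between_levels (f := Complex.re) continuous_re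
        (show -1 + ν ≤ 1 - ν by linarith) hK₀c hK₀conn
        ⟨_, ⟨z1, hz1, rfl⟩, hre1⟩ ⟨_, ⟨z0, hz0, rfl⟩, hre0⟩
    refine ⟨K₁, ?_, hK₁c, ⟨⟨pa, hpa⟩, hK₁conn⟩, ?_, ⟨pa, hpa, hpar⟩, ⟨pb, hpb, hpbr⟩⟩
    · intro p hp
      obtain ⟨z, hz, rfl⟩ := hK₁K hp
      exact ⟨hK₁bd _ hp, him z hz⟩
    · intro p hp
      obtain ⟨z, hz, rfl⟩ := hK₁K hp
      rw [hG, Homeomorph.apply_symm_apply]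
      exact hCO z hz

end SelfDualDualChain

/-- **Registered sub-goal `selfDual_chart_atLeastOne` (line `registered`, lead c4; W3 self-duality,
part B "at least one").**  For a chart `Φ`, a mesh `δ > 0` and `0 < ν ≤ 1` such that `Φ⁻¹` moves
by at most `ν` under plane displacements `≤ 4δ` from points of `Φ(B̄(0,5))`: if the model square
has no open crossing between `Φ(bottom)` and `Φ(top)`
(`¬ ChartCrossed (swapC.trans Φ) (-1) 1 (-1) 1 δ ω`), then the dual configuration, drawn on
`δℤ² + δ(½,½)` (chart `Φ - dualShift δ`), crosses the `ν`-narrower and `ν`-taller rectangle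
`[-1+ν, 1-ν] × [-1-ν, 1+ν]` from left to right
(`SelfDualDualChain.chartCrossed_dualConfig_of_not_chartCrossed`).
[cite: SchrammSmirnov2011, proof of Lemma 6.1] -/
theorem selfDual_chart_atLeastOne : ∀ (Φ : ℂ ≃ₜ ℂ) (δ ν : ℝ), 0 < δ → 0 < ν → ν ≤ 1 → (∀ p q : ℂ, q ∈ Φ '' Metric.closedBall (0 : ℂ) 5 → dist p q ≤ 4 * δ → dist (Φ.symm p) (Φ.symm q) ≤ ν) → ∀ ω : Literature.Probability.Percolation.BondConfig (Literature.Probability.LatticeModels.Site 2), ¬ Literature.Probability.Percolation.SSContinuity.ChartCrossed (Literature.Probability.Percolation.SSContinuity.swapC.trans Φ) (-1) 1 (-1) 1 δ ω → Literature.Probability.Percolation.SSContinuity.ChartCrossed (Φ.trans (Homeomorph.addRight (-Literature.Probability.Percolation.SSContinuity.dualShift δ))) (-1 + ν) (1 - ν) (-1 - ν) (1 + ν) δ (Literature.Probability.Percolation.dualConfig ω) :=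
  fun Φ _ _ hδ _ hν1 hmod _ hncr =>
    SelfDualDualChain.chartCrossed_dualConfig_of_not_chartCrossed Φ hδ hν1 hmod hncr

end Summit.CriticalPhenomena.CardyFormulaZ2.Cruxes.SubseqCardy.Birth
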